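import Literature.Geometry.Kaehler.ComplexTorusHodgeGroupHodgeCircleSigmaPiComplexPoints
import Literature.Geometry.Kaehler.ComplexTorusHodgeGroupHodgeCircleSigmaPiNonCMFactor
import Literature.Geometry.Kaehler.ComplexTorusMumfordTateGroupIrreducible
import HarnessLib

/-!
# The COMPLEX points of the Mumford–Tate group of a finite product `∏ₖ X_k` of complex tori on the Hodge-circle
# locus, `MT(∏ₖ X_k)(ℂ) = ℂ^× · {diag_k(ν_k(u_{d(k)}))} = {diag_k(h_{ℂ,k}(z_{d(k)}, w_{d(k)})) : z_i w_i constant}`, and the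
# complex points of `Hg` and `MT` of the mixed family `E × ∏ₖ X_k` with `End_ℚ(E) = ℚ`
# (Imai 1976 §2 Proposition, §3 Remarks; Moonen–Zarhin 1999 §3 Theorem (Hazama) (2), §3 Corollary; Lange 2023 Remark 7.2.2 (2))

Layer `Literature/Geometry/Kaehler`, namespace `Literature.Geometry.Kaehler.ComplexTorus`; lane `lit-hodgefound`
(Track 2 foundations library), Layer A3/A4 (Hodge groups and Mumford–Tate groups; CM abelian varieties); prover seat
`lit-hodgefound-p17` (generation 35, self-proposed row g35-#5: the Mumford–Tate half of FREE POINTER (σ) and the complex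
points of the mixed family of g35-#2). Sequel, BY NAME and without restating anything, of g35-#4
`ComplexTorusHodgeGroupHodgeCircleSigmaPiComplexPoints` (`mem_hodgeGroupC_sigmaPiPeriod_iff_exists_of_homColouring`:
`Hg(∏ₖ X_k)(ℂ) = {diag_k(ν_k(u_{d(k)}))}`), of g35-#2 `ComplexTorusHodgeGroupHodgeCircleSigmaPiNonCMFactor`
(`hodgeGroupC_sigmaPiPeriod_comm_of_coe_eq_range`), of p22's `ComplexTorusMumfordTateGroupComplexPoints` /
`ComplexTorusMumfordTateGroup` (`mem_mumfordTateGroupC_iff_exists_eq_scalar_mul`: `MT(ℂ) = ℂ^× · Hg(ℂ)`;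
`toGL_mem_mumfordTateGroupC`), of p22's `ComplexTorusMumfordTateGroupCocharacter` / `…ConjugateCocharacters` /
`…MaximalTorus` (`hodgeSC`, `hodgeSCGL`, `hodgeSCGL_mem_mumfordTateGroupC`, `hodgeSCGL_self`, `toGL_complexCircleHom_eq_hodgeSCGL`),
of g15's `ComplexTorusMumfordTateGroupSigmaPi` (`sigmaBlockDiagGL σ ℂ`, `coe_sigmaBlockDiagGL`, `toGL_sigmaBlockDiagSL`,
`hodgeS_sigmaPiPeriod`) and of p40/p14's `ComplexTorusHodgeGroupProductNonCMEllipticCurve` / `ComplexTorusMumfordTateGroupProduct`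
(the two-factor Hazama theorem on complex points `hodgeGroupC_prod_eq_of_endAlgRat_eq_bot`, `blockDiagC`, `toGL_blockDiagC`).
THEOREMS ONLY (no definition, no instance, no named fact; D-0026 net debt 0).

## Sources, verbatim

* H. Imai, *On the Hodge groups of some abelian varieties*, Kōdai Math. Sem. Rep. 27 (1976), §2 Proposition (p. 368
  L11–L13) and its last case (p. 370 L10–L19); §3 Remarks (p. 370 L31–L40): "`Hg(A) = Δ_{m₁}(Hg(E₁)) × ⋯ × Δ_{m_k}(Hg(E_k))`
  where `Δ_m` denotes the diagonal"; "if `E` is not isogenous to any `E_i^{(j)}` … `Hg(E × A) = Hg(E) × Hg(A)`".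
* B. Moonen, Yu. G. Zarhin, Math. Ann. 315 (1999), §3 Theorem (Hazama) (2) (held `paper:arxiv-math_9901113`, p0006
  L70–L76): "`X₁` has no factors of Type IV and `X₂` is of CM-type ⟹ `Hg(X₁ × X₂) = Hg(X₁) × Hg(X₂)`"; §1 (p0002
  L138–L141); §2 (2.2) "`Hg(X) = U_F`"; §3 Corollary (p0007 L80–L85).
* H. Lange, *Abelian Varieties over the Complex Numbers* (2023), §7.2.1 Remark 7.2.2 (2):
  "`(𝔾_m · Hg(X))(ℂ) = {α · M ∈ GL(V_ℂ) | α ∈ ℂ*, M ∈ Hg(X)(ℂ)}`".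
* B. Moonen, *An introduction to Mumford–Tate groups* (2004), (3.2) (`S(ℂ) = ℂ^∗ × ℂ^∗`, `h_ℂ`), §4 (4.6) Lemma
  (`MT(V₁ ⊕ V₂) ⊂ MT(V₁) × MT(V₂)`).
* J. Carlson, S. Müller-Stach, C. Peters, *Period Mappings and Period Domains* (2017), §15.2 Examples 15.2.4 (ii)
  ("`MT(H¹(C))(ℚ) = Res_{K/ℚ} K^×`").

## What is proved (`ν_k = complexCircleHom (Ψ k)`, `h_{ℂ,k} = hodgeSCGL (Ψ k)`, `d : κ → R` a `Hom`-colouring)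

* §1 (ANY family): `hodgeSC_sigmaPiPeriod`, `hodgeSCGL_sigmaPiPeriod` (`h_{ℂ,∏}(z, w) = diag_k h_{ℂ,k}(z, w)`),
  `scalar_mul_toGL_complexCircleHom` (`α · ν(u) = h_ℂ(αu, αu⁻¹)`), `scalar_mul_sigmaBlockDiagGL`,
  `scalar_mul_toGL_sigmaBlockDiagSL_complexCircleHom` (`α · diag_k ν_k(v_k) = diag_k h_{ℂ,k}(αv_k, αv_k⁻¹)`).
* §2 ON THE LOCUS: **`mem_mumfordTateGroupC_sigmaPiPeriod_iff_exists_scalar_mul_toGL_of_homColouring`**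
  (`g ∈ MT(∏ₖ X_k)(ℂ) ⟺ g = α · diag_k(ν_k(u_{d(k)}))`), **`mem_mumfordTateGroupC_sigmaPiPeriod_iff_exists_of_homColouring`**
  (`⟺ g = diag_k(h_{ℂ,k}(z_{d(k)}, w_{d(k)}))` with `z_i w_i` independent of `i` — the split torus `𝔾_m^{R+1}`, resp. `𝔾_m`
  for `κ = ∅`), `sigmaBlockDiagGL_hodgeSCGL_comp_mem_mumfordTateGroupC_sigmaPiPeriod`, colouring-free
  `mem_mumfordTateGroupC_sigmaPiPeriod_iff_exists_scalar_mul_toGL_of_coe_eq_range`.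
* §3 THE MIXED FAMILY on complex points (`End_ℚ(E) = ℚ`, `dim E = 1`): **`hodgeGroupC_prod_sigmaPiPeriod_eq_of_endAlgRat_eq_bot`**
  (`Hg(E × ∏ₖ X_k)(ℂ) = SL₂(ℂ) × Hg(∏ₖ X_k)(ℂ)`, p40's Hazama theorem with the commutativity discharged on the locus),
  **`mem_hodgeGroupC_prod_sigmaPiPeriod_iff_exists_of_homColouring`** (`M = (A 0; 0 diag_k ν_k(u_{d(k)}))`, `A ∈ SL₂(ℂ)`),
  **`mem_mumfordTateGroupC_prod_sigmaPiPeriod_iff_exists_of_homColouring`** (`g = α · (A 0; 0 diag_k ν_k(u_{d(k)}))`), and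
  the `E_τ` (`End = ℤ`) specialisations.

## References

* [Imai1976HodgeGroups] H. Imai, Kōdai Math. Sem. Rep. 27 (1976), §2 Proposition, §3 Remarks (p. 370).
* [MoonenZarhin1999LowDim] B. Moonen, Yu. Zarhin, Math. Ann. 315 (1999), §1, §2 (2.2), §3 Theorem (2), §3 Corollary.
* [Lange2023AbelianVarietiesComplex] H. Lange (2023), §7.2.1 Remark 7.2.2 (2).
* [Moonen2004MT] B. Moonen (2004), (3.2), §4 (4.6) Lemma.
* [CarlsonMullerStachPeters2017] J. Carlson, S. Müller-Stach, C. Peters (2017), §15.2 Examples 15.2.4 (ii).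
-/

noncomputable section

open scoped Real MatrixGroups
open Complex Module Matrix Function

namespace Literature.Geometry.Kaehler

namespace ComplexTorus

/-! ## §1 Block form of `h_ℂ` on a product; scalars times `ν` -/

section Blocks

variable {ι : Type*} [Fintype ι] [DecidableEq ι] {E : Type*} [NormedAddCommGroup E] [NormedSpace ℂ E]
  (Φ : (ι → ℝ) ≃L[ℝ] E)

/-- **`α · ν(u) = h_ℂ(αu, αu⁻¹)` in `GL(V_ℂ)`** (`α · 1 = h_ℂ(α, α)`). [cite: Moonen2004MT, (3.2)]
[cite: Lange2023AbelianVarietiesComplex, §7.2.1 Remark 7.2.2 (2)] -/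
theorem scalar_mul_toGL_complexCircleHom (α u : ℂˣ) :
    Matrix.GeneralLinearGroup.scalar ι α * Matrix.SpecialLinearGroup.toGL (complexCircleHom Φ u) =
      hodgeSCGL Φ (α * u, α * u⁻¹) := by
  rw [toGL_complexCircleHom_eq_hodgeSCGL, ← hodgeSCGL_self Φ α, ← map_mul, Prod.mk_mul_mk]

variable {κ : Type*} [Fintype κ] [DecidableEq κ] {σ : κ → Type*} [∀ k, Fintype (σ k)] [∀ k, DecidableEq (σ k)]
  {F : κ → Type*} [∀ k, NormedAddCommGroup (F k)] [∀ k, NormedSpace ℂ (F k)]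
  (Ψ : ∀ k, (σ k → ℝ) ≃L[ℝ] F k)

omit [Fintype ι] [DecidableEq ι] in
/-- **`h_{ℂ,∏}(z, w) = diag_k(h_{ℂ,k}(z, w))`** (`J_∏ = diag(J_k)`). [cite: Moonen2004MT, (3.2) and §4 (4.6) Lemma] -/
theorem hodgeSC_sigmaPiPeriod (z w : ℂ) :
    hodgeSC (sigmaPiPeriod Ψ) z w = Matrix.blockDiagonal' fun k ↦ hodgeSC (Ψ k) z w := by
  have hfun : (fun k ↦ hodgeSC (Ψ k) z w) = ((z + w) / 2) • (1 : ∀ k, Matrix (σ k) (σ k) ℂ) +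
      ((z - w) / (2 * I)) • fun k ↦ (jMatrix (Ψ k)).map Complex.ofRealHom := by
    funext k; rfl
  rw [hodgeSC, jMatrix_sigmaPiPeriod, Matrix.blockDiagonal'_map _ _ (map_zero _), hfun, Matrix.blockDiagonal'_add,
    Matrix.blockDiagonal'_smul, Matrix.blockDiagonal'_smul, Matrix.blockDiagonal'_one]

omit [Fintype ι] [DecidableEq ι] in
/-- The same in `GL`: `hodgeSCGL (sigmaPiPeriod Ψ) p = sigmaBlockDiagGL (h_{ℂ,k}(p))_k`. [cite: Moonen2004MT, (3.2) and §4 (4.6) Lemma] -/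
theorem hodgeSCGL_sigmaPiPeriod (p : ℂˣ × ℂˣ) :
    hodgeSCGL (sigmaPiPeriod Ψ) p = sigmaBlockDiagGL σ ℂ fun k ↦ hodgeSCGL (Ψ k) p :=
  Units.ext (by rw [coe_hodgeSCGL, coe_sigmaBlockDiagGL, hodgeSC_sigmaPiPeriod]; rfl)

omit [Fintype ι] [DecidableEq ι] in
/-- Scalars act blockwise: `α · diag_k(A_k) = diag_k(α · A_k)`. [cite: Moonen2004MT, §4 (4.6) Lemma] -/
theorem scalar_mul_sigmaBlockDiagGL (α : ℂˣ) (A : ∀ k, GL (σ k) ℂ) :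
    Matrix.GeneralLinearGroup.scalar (Σ k, σ k) α * sigmaBlockDiagGL σ ℂ A =
      sigmaBlockDiagGL σ ℂ fun k ↦ Matrix.GeneralLinearGroup.scalar (σ k) α * A k := by
  refine Units.ext ?_
  have hk : ∀ k, ((Matrix.GeneralLinearGroup.scalar (σ k) α * A k : GL (σ k) ℂ) : Matrix (σ k) (σ k) ℂ) =
      (α : ℂ) • (A k : Matrix (σ k) (σ k) ℂ) := fun k ↦ by
    rw [Units.val_mul, Matrix.GeneralLinearGroup.coe_scalar, Matrix.scalar_apply, ← Matrix.smul_one_eq_diagonal,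
      smul_one_mul]
  rw [Units.val_mul, Matrix.GeneralLinearGroup.coe_scalar, Matrix.scalar_apply, ← Matrix.smul_one_eq_diagonal,
    smul_one_mul, coe_sigmaBlockDiagGL, coe_sigmaBlockDiagGL, ← Matrix.blockDiagonal'_smul]
  congr 1
  funext k
  rw [Pi.smul_apply, hk]

omit [Fintype ι] [DecidableEq ι] in
/-- **`α · diag_k(ν_k(v_k)) = diag_k(h_{ℂ,k}(αv_k, αv_k⁻¹))`.** [cite: Moonen2004MT, (3.2) and §4 (4.6) Lemma]
[cite: Lange2023AbelianVarietiesComplex, §7.2.1 Remark 7.2.2 (2)] -/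
theorem scalar_mul_toGL_sigmaBlockDiagSL_complexCircleHom (α : ℂˣ) (v : κ → ℂˣ) :
    Matrix.GeneralLinearGroup.scalar (Σ k, σ k) α *
        Matrix.SpecialLinearGroup.toGL (sigmaBlockDiagSL σ ℂ fun k ↦ complexCircleHom (Ψ k) (v k)) =
      sigmaBlockDiagGL σ ℂ fun k ↦ hodgeSCGL (Ψ k) (α * v k, α * (v k)⁻¹) := by
  rw [toGL_sigmaBlockDiagSL, scalar_mul_sigmaBlockDiagGL]
  congr 1
  funext k
  exact scalar_mul_toGL_complexCircleHom (Ψ k) α (v k)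

end Blocks

/-! ## §2 `MT(∏ₖ X_k)(ℂ)` on the locus -/

section Locus

variable {κ : Type*} [Fintype κ] [DecidableEq κ] {σ : κ → Type*} [∀ k, Fintype (σ k)] [∀ k, DecidableEq (σ k)]
  {F : κ → Type*} [∀ k, NormedAddCommGroup (F k)] [∀ k, NormedSpace ℂ (F k)] [∀ k, FiniteDimensional ℂ (F k)]
  (Ψ : ∀ k, (σ k → ℝ) ≃L[ℝ] F k) {R : Type*} [Fintype R] [DecidableEq R] {d : κ → R}

/-- **`MT(∏ₖ X_k)(ℂ) = ℂ^× · Hg(∏ₖ X_k)(ℂ)` on the locus: `g ∈ MT(∏ₖ X_k)(ℂ) ⟺ g = α · diag_k(ν_k(u_{d(k)}))`**, `α ∈ ℂ^×`,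
`u ∈ (ℂ^×)^R` (Lange's display with g35-#4). [cite: Lange2023AbelianVarietiesComplex, §7.2.1 Remark 7.2.2 (2)]
[cite: Imai1976HodgeGroups, §3 Remarks (p. 370 L31–L38)] [cite: MoonenZarhin1999LowDim, §1 and §3 Corollary] -/
theorem mem_mumfordTateGroupC_sigmaPiPeriod_iff_exists_scalar_mul_toGL_of_homColouring (hg : ∀ k, 0 < finrank ℂ (F k))
    (h : ∀ k, (hodgeGroup (Ψ k) : Set (SpecialLinearGroup (σ k) ℝ)) = Set.range (hodgeCircleSL (Ψ k)))
    (hd : ∀ k l, d k = d l ↔ homRat (Ψ k) (Ψ l) ≠ ⊥) (hsurj : Surjective d) {g : GL (Σ k, σ k) ℂ} :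
    g ∈ mumfordTateGroupC (sigmaPiPeriod Ψ) ↔ ∃ (α : ℂˣ) (u : R → ℂˣ),
      g = Matrix.GeneralLinearGroup.scalar (Σ k, σ k) α *
        Matrix.SpecialLinearGroup.toGL (sigmaBlockDiagSL σ ℂ fun k ↦ complexCircleHom (Ψ k) (u (d k))) := by
  rw [mem_mumfordTateGroupC_iff_exists_eq_scalar_mul]
  constructor
  · rintro ⟨α, N, hN, rfl⟩
    obtain ⟨u, rfl⟩ := (mem_hodgeGroupC_sigmaPiPeriod_iff_exists_of_homColouring Ψ hg h hd hsurj).1 hN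
    exact ⟨α, u, rfl⟩
  · rintro ⟨α, u, rfl⟩
    exact ⟨α, _, sigmaBlockDiagSL_complexCircleHom_comp_mem_hodgeGroupC_sigmaPiPeriod Ψ hg h hd hsurj u, rfl⟩

/-- **THE THEOREM (ℂ-points of `MT` of a product of locus tori).  `g ∈ MT(∏ₖ X_k)(ℂ) ⟺
g = diag_k(h_{ℂ,k}(z_{d(k)}, w_{d(k)}))` with `z, w ∈ (ℂ^×)^R` and `z_i w_i` independent of `i`** (the common value is the
multiplier) — the split torus of Moonen–Zarhin's `MT = T_F` on the product, one pair of eigenvalues per `Hom`-class tied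
by the weight. `⟸` WITHOUT square roots: `diag_k h_k(z_i, w_i) = h_{ℂ,∏}(c, 1) · diag_k ν_k(z_i / c)` for `c = z_i w_i`.
[cite: MoonenZarhin1999LowDim, §2 (2.2) and §3 Corollary] [cite: CarlsonMullerStachPeters2017, §15.2 Examples 15.2.4 (ii)]
[cite: Moonen2004MT, (3.2) and §4 (4.6) Lemma] [cite: Imai1976HodgeGroups, §3 Remarks (p. 370 L31–L38)] -/
theorem mem_mumfordTateGroupC_sigmaPiPeriod_iff_exists_of_homColouring (hg : ∀ k, 0 < finrank ℂ (F k))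
    (h : ∀ k, (hodgeGroup (Ψ k) : Set (SpecialLinearGroup (σ k) ℝ)) = Set.range (hodgeCircleSL (Ψ k)))
    (hd : ∀ k l, d k = d l ↔ homRat (Ψ k) (Ψ l) ≠ ⊥) (hsurj : Surjective d) {g : GL (Σ k, σ k) ℂ} :
    g ∈ mumfordTateGroupC (sigmaPiPeriod Ψ) ↔ ∃ z w : R → ℂˣ, (∀ i j, z i * w i = z j * w j) ∧
      g = sigmaBlockDiagGL σ ℂ fun k ↦ hodgeSCGL (Ψ k) (z (d k), w (d k)) := by
  constructor
  · intro hg'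
    obtain ⟨α, u, rfl⟩ :=
      (mem_mumfordTateGroupC_sigmaPiPeriod_iff_exists_scalar_mul_toGL_of_homColouring Ψ hg h hd hsurj).1 hg'
    refine ⟨fun i ↦ α * u i, fun i ↦ α * (u i)⁻¹, fun i j ↦ ?_, ?_⟩
    · rw [mul_mul_mul_comm, mul_inv_cancel, mul_mul_mul_comm, mul_inv_cancel]
    · rw [scalar_mul_toGL_sigmaBlockDiagSL_complexCircleHom]
  · rintro ⟨z, w, hzw, rfl⟩
    rcases isEmpty_or_nonempty R with hR | ⟨⟨i₀⟩⟩
    · haveI : IsEmpty κ := ⟨fun k ↦ hR.elim (d k)⟩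
      have h1 : (fun k ↦ hodgeSCGL (Ψ k) (z (d k), w (d k))) = 1 := funext fun k ↦ isEmptyElim k
      rw [h1, map_one]
      exact Subgroup.one_mem _
    · -- `c = z_{i₀} w_{i₀} = z_i w_i`; `h_k(z_i, w_i) = h_k(c, 1) · ν_k(z_i c⁻¹)`
      have hw : ∀ i, w i = z i₀ * w i₀ * (z i)⁻¹ := fun i ↦ by
        rw [eq_mul_inv_iff_mul_eq, mul_comm, hzw i i₀]
      have hfac : (fun k ↦ hodgeSCGL (Ψ k) (z (d k), w (d k))) =
          (fun k ↦ hodgeSCGL (Ψ k) (z i₀ * w i₀, 1)) *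
            fun k ↦ Matrix.SpecialLinearGroup.toGL (complexCircleHom (Ψ k) (z (d k) * (z i₀ * w i₀)⁻¹)) := by
        funext k
        rw [Pi.mul_apply, toGL_complexCircleHom_eq_hodgeSCGL, ← map_mul, Prod.mk_mul_mk, one_mul, hw (d k),
          mul_comm (z i₀ * w i₀) (z (d k) * (z i₀ * w i₀)⁻¹), inv_mul_cancel_right, _root_.mul_inv_rev, inv_inv]
      rw [hfac, map_mul, ← hodgeSCGL_sigmaPiPeriod, ← toGL_sigmaBlockDiagSL]
      exact Subgroup.mul_mem _ (hodgeSCGL_mem_mumfordTateGroupC _ _ _)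
        (toGL_mem_mumfordTateGroupC _
          (sigmaBlockDiagSL_complexCircleHom_comp_mem_hodgeGroupC_sigmaPiPeriod Ψ hg h hd hsurj fun i ↦
            z i * (z i₀ * w i₀)⁻¹))

/-- **`diag_k(h_{ℂ,k}(z_{d(k)}, w_{d(k)})) ∈ MT(∏ₖ X_k)(ℂ)` whenever `z_i w_i` is independent of `i`.**
[cite: MoonenZarhin1999LowDim, §2 (2.2) and §3 Corollary] [cite: Moonen2004MT, §4 (4.6) Lemma] -/
theorem sigmaBlockDiagGL_hodgeSCGL_comp_mem_mumfordTateGroupC_sigmaPiPeriod (hg : ∀ k, 0 < finrank ℂ (F k))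
    (h : ∀ k, (hodgeGroup (Ψ k) : Set (SpecialLinearGroup (σ k) ℝ)) = Set.range (hodgeCircleSL (Ψ k)))
    (hd : ∀ k l, d k = d l ↔ homRat (Ψ k) (Ψ l) ≠ ⊥) (hsurj : Surjective d) {z w : R → ℂˣ}
    (hzw : ∀ i j, z i * w i = z j * w j) :
    sigmaBlockDiagGL σ ℂ (fun k ↦ hodgeSCGL (Ψ k) (z (d k), w (d k))) ∈ mumfordTateGroupC (sigmaPiPeriod Ψ) :=
  (mem_mumfordTateGroupC_sigmaPiPeriod_iff_exists_of_homColouring Ψ hg h hd hsurj).2 ⟨z, w, hzw, rfl⟩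

omit [Fintype R] [DecidableEq R] in
/-- **COLOURING-FREE FORM: `g ∈ MT(∏ₖ X_k)(ℂ) ⟺ g = α · diag_k(ν_k(v_k))` with `v_k = v_l` whenever `Hom_ℚ(X_k, X_l) ≠ 0`.**
[cite: Lange2023AbelianVarietiesComplex, §7.2.1 Remark 7.2.2 (2)] [cite: Imai1976HodgeGroups, §3 Remarks (p. 370 L31–L38)]
[cite: MoonenZarhin1999LowDim, §3 Corollary] -/
theorem mem_mumfordTateGroupC_sigmaPiPeriod_iff_exists_scalar_mul_toGL_of_coe_eq_range (hg : ∀ k, 0 < finrank ℂ (F k))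
    (h : ∀ k, (hodgeGroup (Ψ k) : Set (SpecialLinearGroup (σ k) ℝ)) = Set.range (hodgeCircleSL (Ψ k)))
    {g : GL (Σ k, σ k) ℂ} :
    g ∈ mumfordTateGroupC (sigmaPiPeriod Ψ) ↔ ∃ (α : ℂˣ) (v : κ → ℂˣ), (∀ k l, homRat (Ψ k) (Ψ l) ≠ ⊥ → v k = v l) ∧
      g = Matrix.GeneralLinearGroup.scalar (Σ k, σ k) α *
        Matrix.SpecialLinearGroup.toGL (sigmaBlockDiagSL σ ℂ fun k ↦ complexCircleHom (Ψ k) (v k)) := by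
  rw [mem_mumfordTateGroupC_iff_exists_eq_scalar_mul]
  constructor
  · rintro ⟨α, N, hN, rfl⟩
    obtain ⟨v, hv, rfl⟩ := (mem_hodgeGroupC_sigmaPiPeriod_iff_exists_of_coe_eq_range Ψ hg h).1 hN
    exact ⟨α, v, hv, rfl⟩
  · rintro ⟨α, v, hv, rfl⟩
    exact ⟨α, _, (mem_hodgeGroupC_sigmaPiPeriod_iff_exists_of_coe_eq_range Ψ hg h).2 ⟨v, hv, rfl⟩, rfl⟩

end Locus

/-! ## §3 The mixed family `E × ∏ₖ X_k` (`End_ℚ(E) = ℚ`, `dim E = 1`) on complex points -/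

section Mixed

variable (Φ₀ : (Fin 2 → ℝ) ≃L[ℝ] ℂ)
  {κ : Type*} [Fintype κ] [DecidableEq κ] {σ : κ → Type*} [∀ k, Fintype (σ k)] [∀ k, DecidableEq (σ k)]
  {F : κ → Type*} [∀ k, NormedAddCommGroup (F k)] [∀ k, NormedSpace ℂ (F k)] [∀ k, FiniteDimensional ℂ (F k)]
  (Ψ : ∀ k, (σ k → ℝ) ≃L[ℝ] F k) {R : Type*} [Fintype R] [DecidableEq R] {d : κ → R}

omit [∀ k, FiniteDimensional ℂ (F k)] [Fintype R] [DecidableEq R] in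
/-- **`Hg(E × ∏ₖ X_k)(ℂ) = SL₂(ℂ) × Hg(∏ₖ X_k)(ℂ)`** for a one-dimensional torus `E` with `End_ℚ(E) = ℚ` and ANY finite family
of tori on the locus (p40's two-factor Hazama theorem on complex points, `hodgeGroupC_prod_eq_of_endAlgRat_eq_bot`, BY NAME
with `X₂ := ∏ₖ X_k`, its commutativity hypothesis discharged by g35-#2). [cite: MoonenZarhin1999LowDim, §3 Theorem (2) (p0006 L70–L76)]
[cite: Imai1976HodgeGroups, §2 Proposition (p. 368 L11–L13; last case p. 370 L10–L19)] -/
theorem hodgeGroupC_prod_sigmaPiPeriod_eq_of_endAlgRat_eq_bot (hE : endAlgRat Φ₀ = ⊥)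
    (h : ∀ k, (hodgeGroup (Ψ k) : Set (SpecialLinearGroup (σ k) ℝ)) = Set.range (hodgeCircleSL (Ψ k))) :
    hodgeGroupC (prodPeriod Φ₀ (sigmaPiPeriod Ψ)) =
      ((⊤ : Subgroup SL(2, ℂ)).prod (hodgeGroupC (sigmaPiPeriod Ψ))).map (blockDiagC (Fin 2) (Σ k, σ k)) :=
  hodgeGroupC_prod_eq_of_endAlgRat_eq_bot Φ₀ (sigmaPiPeriod Ψ) hE fun _ _ hM hN ↦
    congrArg Subtype.val (hodgeGroupC_sigmaPiPeriod_comm_of_coe_eq_range Ψ h hM hN)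

/-- **`M ∈ Hg(E × ∏ₖ X_k)(ℂ) ⟺ M = (A 0; 0 diag_k(ν_k(u_{d(k)})))`, `A ∈ SL₂(ℂ)` ARBITRARY, `u ∈ (ℂ^×)^R`** — the group
`SL₂(ℂ) × 𝔾_m(ℂ)^R` (Imai: `Hg(E × A) = Hg(E) × Hg(A)`, read on complex points). [cite: Imai1976HodgeGroups, §3 Remarks (p. 370 L38–L40)]
[cite: MoonenZarhin1999LowDim, §3 Theorem (2) and §3 Corollary] -/
theorem mem_hodgeGroupC_prod_sigmaPiPeriod_iff_exists_of_homColouring (hE : endAlgRat Φ₀ = ⊥)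
    (hg : ∀ k, 0 < finrank ℂ (F k))
    (h : ∀ k, (hodgeGroup (Ψ k) : Set (SpecialLinearGroup (σ k) ℝ)) = Set.range (hodgeCircleSL (Ψ k)))
    (hd : ∀ k l, d k = d l ↔ homRat (Ψ k) (Ψ l) ≠ ⊥) (hsurj : Surjective d)
    {M : SpecialLinearGroup (Fin 2 ⊕ Σ k, σ k) ℂ} :
    M ∈ hodgeGroupC (prodPeriod Φ₀ (sigmaPiPeriod Ψ)) ↔ ∃ (A : SL(2, ℂ)) (u : R → ℂˣ),
      M = blockDiagC (Fin 2) (Σ k, σ k) (A, sigmaBlockDiagSL σ ℂ fun k ↦ complexCircleHom (Ψ k) (u (d k))) := by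
  rw [hodgeGroupC_prod_sigmaPiPeriod_eq_of_endAlgRat_eq_bot Φ₀ Ψ hE h, Subgroup.mem_map]
  constructor
  · rintro ⟨⟨A, N⟩, hAN, rfl⟩
    obtain ⟨u, hu⟩ :
        ∃ u : R → ℂˣ, N = sigmaBlockDiagSL σ ℂ fun k ↦ complexCircleHom (Ψ k) (u (d k)) :=
      (mem_hodgeGroupC_sigmaPiPeriod_iff_exists_of_homColouring Ψ hg h hd hsurj).1 (Subgroup.mem_prod.1 hAN).2
    exact ⟨A, u, by rw [hu]⟩
  · rintro ⟨A, u, rfl⟩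
    exact ⟨(A, _), Subgroup.mem_prod.2 ⟨Subgroup.mem_top A,
      sigmaBlockDiagSL_complexCircleHom_comp_mem_hodgeGroupC_sigmaPiPeriod Ψ hg h hd hsurj u⟩, rfl⟩

/-- **`g ∈ MT(E × ∏ₖ X_k)(ℂ) ⟺ g = α · (A 0; 0 diag_k(ν_k(u_{d(k)})))`**, `α ∈ ℂ^×`, `A ∈ SL₂(ℂ)`, `u ∈ (ℂ^×)^R` — the group
`ℂ^× · (SL₂(ℂ) × 𝔾_m(ℂ)^R)` (Lange's display `MT(ℂ) = ℂ^× · Hg(ℂ)`). [cite: Lange2023AbelianVarietiesComplex, §7.2.1 Remark 7.2.2 (2)]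
[cite: MoonenZarhin1999LowDim, §3 Theorem (2) and §3 Corollary] [cite: Imai1976HodgeGroups, §3 Remarks (p. 370 L38–L40)] -/
theorem mem_mumfordTateGroupC_prod_sigmaPiPeriod_iff_exists_of_homColouring (hE : endAlgRat Φ₀ = ⊥)
    (hg : ∀ k, 0 < finrank ℂ (F k))
    (h : ∀ k, (hodgeGroup (Ψ k) : Set (SpecialLinearGroup (σ k) ℝ)) = Set.range (hodgeCircleSL (Ψ k)))
    (hd : ∀ k l, d k = d l ↔ homRat (Ψ k) (Ψ l) ≠ ⊥) (hsurj : Surjective d) {g : GL (Fin 2 ⊕ Σ k, σ k) ℂ} :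
    g ∈ mumfordTateGroupC (prodPeriod Φ₀ (sigmaPiPeriod Ψ)) ↔ ∃ (α : ℂˣ) (A : SL(2, ℂ)) (u : R → ℂˣ),
      g = Matrix.GeneralLinearGroup.scalar (Fin 2 ⊕ Σ k, σ k) α * Matrix.SpecialLinearGroup.toGL
        (blockDiagC (Fin 2) (Σ k, σ k) (A, sigmaBlockDiagSL σ ℂ fun k ↦ complexCircleHom (Ψ k) (u (d k)))) := by
  rw [mem_mumfordTateGroupC_iff_exists_eq_scalar_mul]
  constructor
  · rintro ⟨α, N, hN, rfl⟩
    obtain ⟨A, u, rfl⟩ := (mem_hodgeGroupC_prod_sigmaPiPeriod_iff_exists_of_homColouring Φ₀ Ψ hE hg h hd hsurj).1 hN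
    exact ⟨α, A, u, rfl⟩
  · rintro ⟨α, A, u, rfl⟩
    exact ⟨α, _, (mem_hodgeGroupC_prod_sigmaPiPeriod_iff_exists_of_homColouring Φ₀ Ψ hE hg h hd hsurj).2 ⟨A, u, rfl⟩,
      rfl⟩

/-- `E_τ` with `End(E_τ) = ℤ`: **`M ∈ Hg(E_τ × ∏ₖ X_k)(ℂ) ⟺ M = (A 0; 0 diag_k ν_k(u_{d(k)}))`.**
[cite: Imai1976HodgeGroups, §3 Remarks (p. 370 L38–L40)] [cite: MoonenZarhin1999LowDim, §3 Theorem (2)] -/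
theorem mem_hodgeGroupC_ellipticPeriod_prod_sigmaPiPeriod_iff_of_eq_bot {τ : ℂ} (hτ : τ.im ≠ 0) (hbot : ellipticEnd hτ = ⊥)
    (hg : ∀ k, 0 < finrank ℂ (F k))
    (h : ∀ k, (hodgeGroup (Ψ k) : Set (SpecialLinearGroup (σ k) ℝ)) = Set.range (hodgeCircleSL (Ψ k)))
    (hd : ∀ k l, d k = d l ↔ homRat (Ψ k) (Ψ l) ≠ ⊥) (hsurj : Surjective d)
    {M : SpecialLinearGroup (Fin 2 ⊕ Σ k, σ k) ℂ} :
    M ∈ hodgeGroupC (prodPeriod (ellipticPeriod hτ) (sigmaPiPeriod Ψ)) ↔ ∃ (A : SL(2, ℂ)) (u : R → ℂˣ),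
      M = blockDiagC (Fin 2) (Σ k, σ k) (A, sigmaBlockDiagSL σ ℂ fun k ↦ complexCircleHom (Ψ k) (u (d k))) :=
  mem_hodgeGroupC_prod_sigmaPiPeriod_iff_exists_of_homColouring (ellipticPeriod hτ) Ψ
    ((endAlgRat_ellipticPeriod_eq_bot_iff hτ).2 hbot) hg h hd hsurj

end Mixed



end ComplexTorus

end Literature.Geometry.Kaehler

end
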